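import Mathlib
import Summits.NavierStokesRegularity.NavierStokesRegularity.Theses.SwirlStarvation
import Literature.Analysis.FluidPDE.ClayClassLerayHopfUniqueness
import HarnessLib

/-!
# `SwirlStarvation.Assembly` — the route's (negative) assembly (item stmt-NavierStokesRegularity-13889;
  pure logic)

**Statement.** `MarginalCreepBlowup → BlowupClayUniqueness → ¬ NavierStokesRegularity`.

PROOF. If Clay (A) held, the blow-up witness's datum `u 0` (smooth, divergence free, rapidly decaying)
would have a global smooth solution `U`; Clay uniqueness gives `U = u` on `[0, T)`, so `U|[0, T+1)` is
a smooth extension of `u` past `T` — contradicting maximality.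

HONEST FRAMING: glue between the route's own statements about a HYPOTHETICAL blow-up; nothing here
bears on the regularity problem itself.
-/

noncomputable section

set_option linter.dupNamespace false

namespace Summit.NavierStokesRegularity.NavierStokesRegularity.Theorems

open Set
open Literature.Analysis Literature.Analysis.FluidPDE

/-- **Item stmt-NavierStokesRegularity-13889** (`SwirlStarvation.Assembly`). [this file] -/
theorem swirlStarvation_assembly_proof :
    Summit.NavierStokesRegularity.NavierStokesRegularity.Theses.SwirlStarvation.Assembly := by
  unfold Summit.NavierStokesRegularity.NavierStokesRegularity.Theses.SwirlStarvation.Assembly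
    Summit.NavierStokesRegularity.NavierStokesRegularity.Theses.SwirlStarvation.MarginalCreepBlowup
    Summit.NavierStokesRegularity.NavierStokesRegularity.Theses.SwirlStarvation.BlowupClayUniqueness
  rintro ⟨ν, hν, T, hT, u, p, hmax, hLH, hdec, -, -⟩ hUniq hClay
  have hcl := hmax.1
  have h0 : (0 : ℝ) ∈ Ico 0 T := ⟨le_rfl, hT⟩
  have hsm : ContDiff ℝ (⊤ : ℕ∞) (u 0) := hcl.contDiff_velocity h0
  have hdiv : NSWave0.IsDivFree (u 0) := fun x => hcl.divFree 0 h0 x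
  obtain ⟨U, P, hU, hP, hns, hE⟩ := hClay ν hν (u 0) hsm hdiv hdec
  have hagree : ∀ t ∈ Ico 0 T, U t = u t :=
    hUniq ν hν (u 0) hdec U u P p T hT hU hP hns hE hcl hLH rfl
  have hT1 : 0 < T + 1 := by linarith
  have hclU : IsClassicalNSSolutionOn (Ico 0 (T + 1)) ν 0 U P :=
    (hns.isClassicalNSSolutionOn_Icc hU hP hT1).mono (fun _ hs => ⟨hs.1, hs.2.le⟩)
      (uniqueDiffOn_Ico 0 (T + 1))
  exact hmax.2 ⟨T + 1, by linarith, U, P, hclU, hagree⟩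

end Summit.NavierStokesRegularity.NavierStokesRegularity.Theorems

end
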